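import Summits.CriticalPhenomena.PercolationContinuityZ3.Theorems.SahiMasterFamilyHSharpThree

/-!
# Conjecture H♭ — the singleton-weighted capping inequality `Σ_t β_{t}·Φ_k(cap_t β) ≤ k·Φ_k(β)` on the union-closed hull:
# typed; `H♯ ⟹ H♭ ⟹ (UC-hull)`; the vertex case (every order); H♭(3) on the bare box

Unit `prim-masterthm-p4` (gen 18; crux anchor stmt-CriticalPhenomena-4575, helper work; memo
`run/shared/lean/prim/prim-masterthm/prim-masterthm-p4/P4-GEN18-REPORT.md` §2).  Companion of `…HSharp` / `…HSharpThree`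
(gen 17: the typed conjecture `HSharpNonneg k` = H♯(k): `Σ_t Φ_k(cap_t β) ≤ k·Φ_k(β)`, `H♯ ⟹ (UC-hull)`, H♯(3)).

For a point `β` of the union-closed hull write `d = 1 − β`, `W_R(d) = Σ_{σ ∈ Sym R} ∏_{c} d_c` (so that `Φ_k(cap_t β) = W_{[k]∖t}(d)`,
`…PhiCapClosedForm`) and recall the deletion picture of gen 18 (memo §1): with a uniformly random permutation `σ` of `[k]`, independent
labels (union-closed families) on its cycles, and "bad" = "the cycle's support is not in its family",
`k·(Σ_x W_{[k]∖x} − W_{[k]}) = LEAVE₁ + LEAVE₂ − ENTER`, where `ENTER` is the mass of (all-bad `σ`, point `y` whose cycle `C` has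
`C∖y` GOOD), `LEAVE₂` the mass of (`σ` with exactly one good cycle `C ∋ y`, `|C| ≥ 2`, `C∖y` bad, all other cycles bad) and
`LEAVE₁ = Σ_y β_{y}·W_{[k]∖y}(d)` the mass of (`σ` whose only good cycle is the singleton `{y}`).  Union-closure enters through ONE
fact: a bad set has AT MOST ONE good co-point.  In this language `(UC-hull)_k ⟺ ENTER ≤ LEAVE₁ + LEAVE₂`,
`H♯(k) ⟺ LEAVE₂ − ENTER ≥ Σ_y d_{y}·W_{[k]∖y}(d)`, and the intermediate statement

**CONJECTURE H♭(k)** (`HFlatNonneg k`, conjecture-valued definition, never a fact):  **`ENTER ≤ LEAVE₂`**, i.e.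
**`Σ_t β_{{t}}·Φ_k(cap_t β) ≤ k·Φ_k(β)`** for every finite mixture `β` of indicators of union-closed families containing `univ`
(memo §2: `k·Φ − Σ_t β_t Φ(cap_t β) = LEAVE₂ − ENTER`).  Since every `Φ_k(cap_t β) ≥ 0` on the box (`HSharp.phiSet_capAt_nonneg`),
**`H♯(k) ⟹ H♭(k) ⟹ (UC-hull)_k`** (`hFlatNonneg_of_hSharpNonneg`, `ucHullNonneg_of_hFlatNonneg`) — a new rung on the ladder
`TH♯ ⟹ H♯ ⟹ H♭ ⟹ (UC-hull) ⟹ (GH) ⟺ PC`.  EVIDENCE (memo §2): exhaustive at all vertices `k ≤ 4` and clean in > 1 000 random hull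
points `k ≤ 6`; the supremum of `ENTER/LEAVE₂` over vertices is `1 − 1/(k−1)` for `k = 3,…,6` (attained at the complementary pair
`{univ, A, Aᶜ}` for `k = 3` and at the "glued pair" families `{S : S ∩ {a,b} ∈ {∅, {a,b}}} ∖ {{a,b}}` — a new infinite family of
H♯-TIGHT vertices, `k·W_{[k]} = (k−1)·Σ_x W_{[k]∖x}` there for every `k ≥ 4`).  Unlike H♯(3), which needs the pairwise-union
inequalities and a sign split (`…HSharpThree`), **H♭(3) holds on the bare box** `0 ≤ β ≤ 1`, `β_univ = 1`:
`3Φ_3(β) − Σ_t β_t Φ_3(cap_t β) = 2·[3 − Σ_i β_i + Σ_{i<j} β_iβ_j − Σ_i β_i β_{[3]∖i}] ≥ 2·Σ_{i<j}(1−β_i)(1−β_j) ≥ 0`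
(`hFlat_three_of_box`, `hFlatNonneg_three`).
HONEST FRAMING: H♭ is a reformulation-born intermediate conjecture; nothing here proves (UC-hull)_k for a new k; (UC-hull)_k for
k ≥ 8, H♯(k) for k ≥ 4, H♭(k) for k ≥ 4, Sahi's `C_k`, Kahn's Conjecture 5 and the master theorem remain OPEN.  Axioms standard. [this work]
-/

noncomputable section

open scoped Classical

namespace Summit.CriticalPhenomena.PercolationContinuityZ3.Theorems

namespace HFlat

open Finset
open Literature.Combinatorics.Sahi2008
open PrincipalCapBeta (phiSet)
open GHConjecture (UCHullNonneg)
open HSharp (HSharpNonneg mixture_le_one phiSet_capAt_nonneg)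

/-- **Conjecture H♭(k)** — on the union-closed hull, `Σ_t β_{{t}}·Φ_k(cap_t β) ≤ k·Φ_k(β)`: capping a uniformly random index `t`
does not increase `Φ_k` on average when the cap at `t` is WEIGHTED by the probability `β_{{t}}` that the singleton `{t}` is good.
Equivalently `ENTER ≤ LEAVE₂` in the deletion picture (module docstring).  A conjecture-valued definition, never a fact. [this work]
[status: open k ≥ 4; exhaustive at the vertices k ≤ 4, clean in random hull points k ≤ 6; k ≤ 3 proved below] -/
@[conjecture] def HFlatNonneg (k : ℕ) : Prop :=
  ∀ (α : Type) [Fintype α] (w : α → ℝ) (𝒰 : α → Finset (Finset (Fin k))),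
    (∀ x, 0 ≤ w x) → ∑ x, w x = 1 → (∀ x, ∀ A ∈ 𝒰 x, ∀ A' ∈ 𝒰 x, A ∪ A' ∈ 𝒰 x) → (∀ x, univ ∈ 𝒰 x) →
      ∑ t : Fin k, (∑ x, w x * (if ({t} : Finset (Fin k)) ∈ 𝒰 x then (1 : ℝ) else 0)) *
          phiSet k (fun S => if t ∈ S then 1 else ∑ x, w x * (if S ∈ 𝒰 x then (1 : ℝ) else 0)) ≤
        (k : ℝ) * phiSet k (fun S => ∑ x, w x * (if S ∈ 𝒰 x then (1 : ℝ) else 0))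

variable {k : ℕ}

/-! ### The ladder: `H♯ ⟹ H♭ ⟹ (UC-hull)` -/

/-- The mixture set function is nonnegative. [this work] -/
theorem mixture_nonneg {α : Type} [Fintype α] (w : α → ℝ) (𝒰 : α → Finset (Finset (Fin k))) (hw0 : ∀ x, 0 ≤ w x)
    (B : Finset (Fin k)) : 0 ≤ ∑ x, w x * (if B ∈ 𝒰 x then (1 : ℝ) else 0) :=
  sum_nonneg fun x _ => mul_nonneg (hw0 x) (by split_ifs <;> norm_num)

/-- Each weighted cap term is at most the unweighted one: `β_{t}·Φ(cap_t β) ≤ Φ(cap_t β)` (since `0 ≤ β_{t} ≤ 1` and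
`Φ(cap_t β) ≥ 0` on the box). [this work] -/
theorem weighted_cap_le {α : Type} [Fintype α] (w : α → ℝ) (𝒰 : α → Finset (Finset (Fin (k + 1)))) (hw0 : ∀ x, 0 ≤ w x)
    (hw1 : ∑ x, w x = 1) (t : Fin (k + 1)) :
    (∑ x, w x * (if ({t} : Finset (Fin (k + 1))) ∈ 𝒰 x then (1 : ℝ) else 0)) *
        phiSet (k + 1) (fun S => if t ∈ S then 1 else ∑ x, w x * (if S ∈ 𝒰 x then (1 : ℝ) else 0)) ≤
      phiSet (k + 1) (fun S => if t ∈ S then 1 else ∑ x, w x * (if S ∈ 𝒰 x then (1 : ℝ) else 0)) := by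
  have hcap : 0 ≤ phiSet (k + 1) (fun S => if t ∈ S then 1 else ∑ x, w x * (if S ∈ 𝒰 x then (1 : ℝ) else 0)) :=
    phiSet_capAt_nonneg _ (mixture_le_one w 𝒰 hw0 hw1) t
  have hb1 : (∑ x, w x * (if ({t} : Finset (Fin (k + 1))) ∈ 𝒰 x then (1 : ℝ) else 0)) ≤ 1 := mixture_le_one w 𝒰 hw0 hw1 _
  nlinarith [hcap, hb1]

/-- **H♯(k) ⟹ H♭(k)**. [this work] -/
theorem hFlatNonneg_of_hSharpNonneg (h : HSharpNonneg k) : HFlatNonneg k := by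
  intro α _ w 𝒰 hw0 hw1 hUC htop
  rcases Nat.eq_zero_or_pos k with hk | hk
  · subst hk
    simp
  · obtain ⟨k', rfl⟩ : ∃ k', k = k' + 1 := ⟨k - 1, (Nat.sub_add_cancel hk).symm⟩
    calc ∑ t : Fin (k' + 1), (∑ x, w x * (if ({t} : Finset (Fin (k' + 1))) ∈ 𝒰 x then (1 : ℝ) else 0)) *
            phiSet (k' + 1) (fun S => if t ∈ S then 1 else ∑ x, w x * (if S ∈ 𝒰 x then (1 : ℝ) else 0))
        ≤ ∑ t : Fin (k' + 1), phiSet (k' + 1) (fun S => if t ∈ S then 1 else ∑ x, w x * (if S ∈ 𝒰 x then (1 : ℝ) else 0)) :=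
          sum_le_sum fun t _ => weighted_cap_le w 𝒰 hw0 hw1 t
      _ ≤ ((k' + 1 : ℕ) : ℝ) * phiSet (k' + 1) (fun S => ∑ x, w x * (if S ∈ 𝒰 x then (1 : ℝ) else 0)) :=
          h α w 𝒰 hw0 hw1 hUC htop

/-- **H♭(k) ⟹ (UC-hull)_k**: `k·Φ(β) ≥ Σ_t β_t·Φ(cap_t β) ≥ 0`. [this work] -/
theorem ucHullNonneg_of_hFlatNonneg (h : HFlatNonneg k) : UCHullNonneg k := by
  intro α _ w 𝒰 hw0 hw1 hUC htop
  rcases Nat.eq_zero_or_pos k with hk | hk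
  · subst hk
    exact PhiProduct.phiSet_zero_nonneg _
  · obtain ⟨k', rfl⟩ : ∃ k', k = k' + 1 := ⟨k - 1, (Nat.sub_add_cancel hk).symm⟩
    have hH := h α w 𝒰 hw0 hw1 hUC htop
    have hsum : 0 ≤ ∑ t : Fin (k' + 1), (∑ x, w x * (if ({t} : Finset (Fin (k' + 1))) ∈ 𝒰 x then (1 : ℝ) else 0)) *
        phiSet (k' + 1) (fun S => if t ∈ S then 1 else ∑ x, w x * (if S ∈ 𝒰 x then (1 : ℝ) else 0)) :=
      sum_nonneg fun t _ => mul_nonneg (mixture_nonneg w 𝒰 hw0 _)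
        (phiSet_capAt_nonneg _ (mixture_le_one w 𝒰 hw0 hw1) t)
    have hpos : (0 : ℝ) < ((k' + 1 : ℕ) : ℝ) := by exact_mod_cast hk
    nlinarith [hH, hsum, hpos]

/-- H♭ down the whole ladder: `H♭(k) ⟹ (GH)_k`. [this work] -/
theorem gSystemNonneg_of_hFlatNonneg (h : HFlatNonneg k) : GHConjecture.GSystemNonneg k :=
  GHConjecture.gSystemNonneg_of_ucHullNonneg (ucHullNonneg_of_hFlatNonneg h)

/-- `TH♯(n) ⟹ H♭(n)` (through H♯). [this work] -/
theorem hFlatNonneg_of_thSharpNonneg {n : ℕ} (h : HSharp.THSharpNonneg n) : HFlatNonneg n :=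
  hFlatNonneg_of_hSharpNonneg (HSharp.hSharpNonneg_of_thSharpNonneg h)

/-! ### The two smallest orders and the vertices (from H♯) -/

/-- H♭(1). [this work] -/
theorem hFlatNonneg_one : HFlatNonneg 1 := hFlatNonneg_of_hSharpNonneg HSharp.hSharpNonneg_one

/-- H♭(2). [this work] -/
theorem hFlatNonneg_two : HFlatNonneg 2 := hFlatNonneg_of_hSharpNonneg HSharp.hSharpNonneg_two

/-- **H♭ at every vertex, every order** (from the sharp vertex inequality (V♯) of gen 17 via `HSharp.hSharp_vertex`): for a
union-closed `𝒰 ∋ univ`, `Σ_t [{t} ∈ 𝒰]·Φ(cap_t 1_𝒰) ≤ (k+1)·Φ(1_𝒰)`. [this work] -/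
theorem hFlat_vertex (𝒰 : Finset (Finset (Fin (k + 1)))) (hU : ∀ A ∈ 𝒰, ∀ B ∈ 𝒰, A ∪ B ∈ 𝒰) (htop : univ ∈ 𝒰) :
    ∑ t : Fin (k + 1), (if ({t} : Finset (Fin (k + 1))) ∈ 𝒰 then (1 : ℝ) else 0) *
        phiSet (k + 1) (fun S => if t ∈ S then 1 else (if S ∈ 𝒰 then (1 : ℝ) else 0)) ≤
      ((k + 1 : ℕ) : ℝ) * phiSet (k + 1) (fun S => if S ∈ 𝒰 then (1 : ℝ) else 0) := by
  have hcap : ∀ t : Fin (k + 1), 0 ≤ phiSet (k + 1) (fun S => if t ∈ S then 1 else (if S ∈ 𝒰 then (1 : ℝ) else 0)) :=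
    fun t => phiSet_capAt_nonneg _ (fun B => by split_ifs <;> norm_num) t
  calc ∑ t : Fin (k + 1), (if ({t} : Finset (Fin (k + 1))) ∈ 𝒰 then (1 : ℝ) else 0) *
          phiSet (k + 1) (fun S => if t ∈ S then 1 else (if S ∈ 𝒰 then (1 : ℝ) else 0))
      ≤ ∑ t : Fin (k + 1), phiSet (k + 1) (fun S => if t ∈ S then 1 else (if S ∈ 𝒰 then (1 : ℝ) else 0)) := by
        refine sum_le_sum fun t _ => ?_
        have h1 : (if ({t} : Finset (Fin (k + 1))) ∈ 𝒰 then (1 : ℝ) else 0) ≤ 1 := by split_ifs <;> norm_num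
        nlinarith [hcap t, h1]
    _ ≤ ((k + 1 : ℕ) : ℝ) * phiSet (k + 1) (fun S => if S ∈ 𝒰 then (1 : ℝ) else 0) := HSharp.hSharp_vertex 𝒰 hU htop

/-! ### H♭(3) on the bare box -/

/-- **The polynomial heart of H♭(3)**: on the box `[0,1]^6` (no union-closure at all),
`0 ≤ 3 − (a+b+c) + (ab+ac+bc) − (pa+qb+rc)` (indeed `≥ (1−a)(1−b) + (1−a)(1−c) + (1−b)(1−c)`). [this work] -/
theorem hflat_three_poly (a b c p q r : ℝ) (ha0 : 0 ≤ a) (ha1 : a ≤ 1) (hb0 : 0 ≤ b) (hb1 : b ≤ 1) (hc0 : 0 ≤ c) (hc1 : c ≤ 1)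
    (hp1 : p ≤ 1) (hq1 : q ≤ 1) (hr1 : r ≤ 1) :
    0 ≤ 3 - (a + b + c) + (a * b + a * c + b * c) - (p * a + q * b + r * c) := by
  nlinarith [mul_nonneg (sub_nonneg.2 ha1) (sub_nonneg.2 hb1), mul_nonneg (sub_nonneg.2 ha1) (sub_nonneg.2 hc1),
    mul_nonneg (sub_nonneg.2 hb1) (sub_nonneg.2 hc1), mul_nonneg ha0 (sub_nonneg.2 hp1), mul_nonneg hb0 (sub_nonneg.2 hq1),
    mul_nonneg hc0 (sub_nonneg.2 hr1)]

/-- **H♭(3) on the bare box**: `Σ_t β_{t}·Φ_3(cap_t β) ≤ 3·Φ_3(β)` for every `0 ≤ β ≤ 1` with `β_univ = 1` — with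
`a,b,c = β_{0},β_{1},β_{2}`, `p,q,r = β_{12},β_{02},β_{01}`: `3Φ_3(β) − Σ_t β_tΦ_3(cap_t β) = 2·[3 − (a+b+c) + (ab+ac+bc) − (pa+qb+rc)]`.
[this work] -/
theorem hFlat_three_of_box (β : Finset (Fin 3) → ℝ) (h0 : ∀ B, 0 ≤ β B) (h1 : ∀ B, β B ≤ 1) (huniv : β univ = 1) :
    ∑ t : Fin 3, β {t} * phiSet 3 (fun S => if t ∈ S then 1 else β S) ≤ (3 : ℝ) * phiSet 3 β := by
  have key := hflat_three_poly (β {0}) (β {1}) (β {2}) (β {1, 2}) (β {0, 2}) (β {0, 1})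
    (h0 _) (h1 _) (h0 _) (h1 _) (h0 _) (h1 _) (h1 _) (h1 _) (h1 _)
  simp only [PrincipalCapBeta.phiSet_three, Fin.sum_univ_three, Fin.isValue, mem_univ, if_true, mem_insert, mem_singleton,
    huniv]
  norm_num [Fin.ext_iff]
  nlinarith [key]

/-- **H♭(3)** (`HFlatNonneg 3`): every mixture of union-closed indicator functions containing `univ` lies in the box with top value
one — no further property of the hull is needed at this order. [this work] -/
theorem hFlatNonneg_three : HFlatNonneg 3 := by
  intro α _ w 𝒰 hw0 hw1 _ htop
  set β : Finset (Fin 3) → ℝ := fun S => ∑ x, w x * (if S ∈ 𝒰 x then (1 : ℝ) else 0) with hβ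
  have h0 : ∀ B, 0 ≤ β B := fun B => mixture_nonneg w 𝒰 hw0 B
  have h1 : ∀ B, β B ≤ 1 := fun B => mixture_le_one w 𝒰 hw0 hw1 B
  have huniv : β univ = 1 := by
    have : ∀ x, w x * (if (univ : Finset (Fin 3)) ∈ 𝒰 x then (1 : ℝ) else 0) = w x := fun x => by
      rw [if_pos (htop x), mul_one]
    simp only [hβ, this, hw1]
  show ∑ t : Fin 3, β {t} * phiSet 3 (fun S => if t ∈ S then 1 else β S) ≤ ((3 : ℕ) : ℝ) * phiSet 3 β
  exact_mod_cast hFlat_three_of_box β h0 h1 huniv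

/-- Down the ladder: yet another proof of `(UC-hull)_3`. [this work] -/
theorem ucHullNonneg_three'' : UCHullNonneg 3 :=
  ucHullNonneg_of_hFlatNonneg hFlatNonneg_three

end HFlat

end Summit.CriticalPhenomena.PercolationContinuityZ3.Theorems
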